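import Literature.Analysis.FunctionSpaces.PoissonPointProcessProofs
import Literature.Analysis.FunctionSpaces.PoissonPointProcessExistence
import Literature.Analysis.FunctionSpaces.PoissonMeckePrelims
import Mathlib.Probability.Independence.Basic
import Mathlib.Probability.Distributions.Poisson.Basic
import HarnessLib

/-!
# The Superposition Theorem for Poisson point processes (Kingman 1993, §2.2)
(topic Analysis/FunctionSpaces, next to `PoissonPointProcess`; DISCHARGES the named fact
`Literature.Analysis.FunctionSpaces.IsPoissonPointProcess.superposition` as
`IsPoissonPointProcess.superposition_holds`)

Setting: `E` a second countable Hausdorff Borel space, `ν₁, ν₂` σ-finite measures on `E`, and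
`P₁, P₂` laws of Poisson point processes (Kingman's axioms, `IsPoissonPointProcess νᵢ Pᵢ`) on the
locally finite simple configurations `PointConfig E` with the count σ-algebra. The superposition of
the two *independent* processes is the image of the product law `P₁ ⊗ P₂` under
`(c, d) ↦ c ∪ d` (measurable: the named fact `PointConfig.measurable_union`, discharged in
`PoissonPointProcessProofs`). We prove, following Kingman, *Poisson Processes* (1993), §2.2:

* **Disjointness Lemma** (Kingman p. 14, (2.15)), in the additive form it is used in:
  for measurable `s` with `ν₁ s < ∞`, almost surely `N_{c ∪ d}(s) = N_c(s) + N_d(s)`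
  (`ae_count_union_eq_add`). Kingman's proof: the joint law is the product `P₁ × P₂`, so by
  Fubini it suffices that for a fixed configuration `c` with finitely many points in `s` (a.s.,
  `ν₁ s < ∞`) the second process a.s. contains none of them — `P₂ {d | a ∈ d} = 0` for every
  point `a`, because the intensity of a simple Poisson process has no atoms of finite mass
  (`IsPoissonPointProcess.measure_setOf_mem_eq_zero`, from `measure_singleton`). With `ν₁, ν₂`
  σ-finite this gives `c ∩ d = ∅` almost surely (`ae_disjoint_carrier`; Kingman p. 15: "it is
  true with `A = S` if `μ₁` and `μ₂` are σ-finite").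
* **Superposition Theorem** (Kingman p. 16, (2.19)–(2.21), the case of two processes): a.s.
  `N(A) = N₁(A) + N₂(A)` for every `A`; for `(ν₁ + ν₂)(A) < ∞` this is a sum of two independent
  Poisson variables, hence Poisson with mean `ν₁(A) + ν₂(A)` (Kingman's Countable Additivity
  Theorem, §1.2 — here Mathlib's `IndepFun.hasLaw_add_map_cast_poissonMeasure`); and for pairwise
  disjoint `A₁, …, Aₙ` the pairs `(N₁(Aⱼ), N₂(Aⱼ))` are independent under `P₁ ⊗ P₂`
  (`iIndepFun_prodMk_prod`: two independent families on the two factors of a product space zip to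
  an independent family), so the sums `N(Aⱼ)` are independent (`superposition_holds`).

Auxiliary, all proved here and stated in the generality they come in: independence of finitely
many discrete random variables is the product rule on joint point values
(`iIndepFun_iff_measure_fiber`); finite sets with `#(A ∪ B) = #A + #B` are disjoint
(`disjoint_of_encard_union_eq_add`); independence is transported to the image law by the tree's
`iIndepFun_map_of_comp_measurable` (`PoissonPointProcessExistence`). No new definitions, no new
named facts.

## References

* J. F. C. Kingman, *Poisson Processes*, Oxford Studies in Probability 3, Clarendon Press, Oxford
  (1993), §2.2 The Superposition Theorem: Disjointness Lemma p. 14 (2.15); Superposition Theorem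
  p. 16 (2.19)–(2.21); Countable Additivity Theorem §1.2 p. 5. [cite: Kingman1993, §2.2]
* G. Last, M. Penrose, *Lectures on the Poisson Process*, Cambridge Univ. Press (2017), Thm 3.3
  (superposition for point processes as counting measures).
-/

open MeasureTheory ProbabilityTheory Filter Set TopologicalSpace
open scoped ENNReal NNReal Topology

namespace Literature.Analysis.FunctionSpaces

/-! ## Configurations: counts of a disjoint superposition, measurability of superposition -/

namespace PointConfig

variable {E : Type*} [TopologicalSpace E]

/-- Counts of a superposition of two *disjoint* configurations add:
`N_{c ∪ d}(s) = N_c(s) + N_d(s)` (Kingman 1993, §2.2, (2.21)). [cite: Kingman1993, §2.2 (2.21)] -/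
theorem count_union_eq_add_of_disjoint {c d : PointConfig E} (h : Disjoint c.carrier d.carrier)
    (s : Set E) : (c ∪ d).count s = c.count s + d.count s := by
  rw [count, count, count, carrier_union, union_inter_distrib_right]
  exact Set.encard_union_eq (h.mono inter_subset_left inter_subset_left)

/-- Superposition `(c, d) ↦ c ∪ d` is measurable on a second countable Hausdorff space with
measurable open sets: the named fact `PointConfig.measurable_union`, discharged as
`PointConfig.measurable_union_holds`, unpacked for use. [cite: Kingman1993, §2.2] -/
theorem measurable_union' [T2Space E] [SecondCountableTopology E] [MeasurableSpace E]
    [OpensMeasurableSpace E] :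
    Measurable fun p : PointConfig E × PointConfig E => p.1 ∪ p.2 := by
  exact measurable_union_holds (E := E)

end PointConfig

namespace IsPoissonPointProcess

/-! ## Elementary facts: independence, finite sets -/

section Elementary

/-- **Independence of discrete random variables is the product rule on point values**: for
finitely many random variables `f i` with values in countable spaces with measurable singletons,
under a probability measure, `(f i)ᵢ` is independent iff
`μ {∀ i, f i = z i} = ∏ᵢ μ {f i = z i}` for every `z` (the joint law and the product of the
marginals are measures on a countable space, determined by their values on singletons).
[folklore] -/
theorem iIndepFun_iff_measure_fiber {Ω ι : Type*} [MeasurableSpace Ω] [Fintype ι] {β : ι → Type*}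
    [∀ i, MeasurableSpace (β i)] [∀ i, Countable (β i)] [∀ i, MeasurableSingletonClass (β i)]
    {μ : Measure Ω} [IsProbabilityMeasure μ] {f : ∀ i, Ω → β i} (hf : ∀ i, Measurable (f i)) :
    iIndepFun f μ ↔ ∀ z : ∀ i, β i, μ {ω | ∀ i, f i ω = z i} = ∏ i, μ {ω | f i ω = z i} := by
  haveI : ∀ i, IsProbabilityMeasure (μ.map (f i)) := fun i =>
    Measure.isProbabilityMeasure_map (hf i).aemeasurable
  rw [iIndepFun_iff_map_fun_eq_pi_map (fun i => (hf i).aemeasurable), Measure.ext_iff_singleton]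
  refine forall_congr' fun z => ?_
  have h1 : (μ.map fun ω i => f i ω) {z} = μ {ω | ∀ i, f i ω = z i} := by
    rw [Measure.map_apply (measurable_pi_lambda _ hf) (measurableSet_singleton z)]
    congr 1
    ext ω
    simp only [mem_preimage, mem_singleton_iff, mem_setOf_eq, funext_iff]
  have h2 : Measure.pi (fun i => μ.map (f i)) {z} = ∏ i, μ {ω | f i ω = z i} := by
    rw [Measure.pi_singleton]
    refine Finset.prod_congr rfl fun i _ => ?_
    rw [Measure.map_apply (hf i) (measurableSet_singleton _)]
    rfl
  rw [h1, h2]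

/-- **Zipping two independent families on a product space.** If `(X i)ᵢ` is an independent family
of discrete random variables on `(Ω₁, μ₁)` and `(Y i)ᵢ` one on `(Ω₂, μ₂)` (probability spaces,
finite index set), then the pairs `(X i, Y i)`, viewed on the product space `(Ω₁ × Ω₂, μ₁ ⊗ μ₂)`,
form an independent family: `(μ₁ ⊗ μ₂){∀ i, (Xᵢ, Yᵢ) = (aᵢ, bᵢ)} = μ₁{∀ i, Xᵢ = aᵢ} μ₂{∀ i, Yᵢ = bᵢ}`
factorises. (Kingman 1993, §2.2, proof of the Superposition Theorem: "the double array of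
variables `N_n(A_j)` are all independent".) [folklore] -/
theorem iIndepFun_prodMk_prod {Ω₁ Ω₂ ι : Type*} [MeasurableSpace Ω₁] [MeasurableSpace Ω₂]
    [Fintype ι] {β γ : ι → Type*}
    [∀ i, MeasurableSpace (β i)] [∀ i, Countable (β i)] [∀ i, MeasurableSingletonClass (β i)]
    [∀ i, MeasurableSpace (γ i)] [∀ i, Countable (γ i)] [∀ i, MeasurableSingletonClass (γ i)]
    {μ₁ : Measure Ω₁} {μ₂ : Measure Ω₂} [IsProbabilityMeasure μ₁] [IsProbabilityMeasure μ₂]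
    {X : ∀ i, Ω₁ → β i} {Y : ∀ i, Ω₂ → γ i} (hX : ∀ i, Measurable (X i))
    (hY : ∀ i, Measurable (Y i)) (h₁ : iIndepFun X μ₁) (h₂ : iIndepFun Y μ₂) :
    iIndepFun (fun i (p : Ω₁ × Ω₂) => (X i p.1, Y i p.2)) (μ₁.prod μ₂) := by
  have hXY : ∀ i, Measurable fun p : Ω₁ × Ω₂ => (X i p.1, Y i p.2) := fun i =>
    ((hX i).comp measurable_fst).prodMk ((hY i).comp measurable_snd)
  rw [iIndepFun_iff_measure_fiber hX] at h₁
  rw [iIndepFun_iff_measure_fiber hY] at h₂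
  refine (iIndepFun_iff_measure_fiber (β := fun i => β i × γ i) hXY).2 fun z => ?_
  show (μ₁.prod μ₂) {p : Ω₁ × Ω₂ | ∀ i, (X i p.1, Y i p.2) = z i} =
    ∏ i, (μ₁.prod μ₂) {p : Ω₁ × Ω₂ | (X i p.1, Y i p.2) = z i}
  have hset : {p : Ω₁ × Ω₂ | ∀ i, (X i p.1, Y i p.2) = z i} =
      {ω | ∀ i, X i ω = (z i).1} ×ˢ {ω | ∀ i, Y i ω = (z i).2} := by
    ext p
    simp only [mem_setOf_eq, mem_prod, Prod.ext_iff, forall_and]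
  have hset' : ∀ i, {p : Ω₁ × Ω₂ | (X i p.1, Y i p.2) = z i} =
      {ω | X i ω = (z i).1} ×ˢ {ω | Y i ω = (z i).2} := fun i => by
    ext p
    simp only [mem_setOf_eq, mem_prod, Prod.ext_iff]
  rw [hset, Measure.prod_prod, h₁, h₂, ← Finset.prod_mul_distrib]
  refine Finset.prod_congr rfl fun i _ => ?_
  rw [hset', Measure.prod_prod]

/-- Finite sets whose union has `#A + #B` elements are disjoint
(`#(A ∪ B) + #(A ∩ B) = #A + #B`). [folklore] -/
theorem disjoint_of_encard_union_eq_add {α : Type*} {A B : Set α} (hA : A.Finite) (hB : B.Finite)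
    (h : (A ∪ B).encard = A.encard + B.encard) : Disjoint A B := by
  have key := Set.encard_union_add_encard_inter A B
  rw [h] at key
  obtain ⟨a, ha⟩ := ENat.ne_top_iff_exists.1 hA.encard_lt_top.ne
  obtain ⟨b, hb⟩ := ENat.ne_top_iff_exists.1 hB.encard_lt_top.ne
  obtain ⟨e, he⟩ := ENat.ne_top_iff_exists.1
    (hA.subset inter_subset_left : (A ∩ B).Finite).encard_lt_top.ne
  rw [← ha, ← hb, ← he] at key
  have h0 : e = 0 := by
    norm_cast at key
    omega
  refine Set.disjoint_iff_inter_eq_empty.2 (Set.encard_eq_zero.1 ?_)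
  rw [← he, h0, Nat.cast_zero]

end Elementary

/-! ## The Disjointness Lemma and the Superposition Theorem -/

variable {E : Type*} [TopologicalSpace E] [MeasurableSpace E]

section Disjointness

variable [T2Space E] [SecondCountableTopology E] [OpensMeasurableSpace E]
  {ν₁ ν₂ : Measure E} {P₁ P₂ : Measure (PointConfig E)}

/-- **Disjointness Lemma** (Kingman, *Poisson Processes* (1993), §2.2, p. 14, (2.15)), additive
form: for independent Poisson processes with laws `P₁, P₂` and a measurable `s` with `ν₁ s < ∞`
(and `ν₂` σ-finite), almost surely under `P₁ ⊗ P₂` the two configurations share no point of `s`,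
so that `N_{c ∪ d}(s) = N_c(s) + N_d(s)`. Kingman's proof: Fubini over the product law; for a fixed
`c` with finitely many points in `s` (a.s.), `P₂ {d | a ∈ d} = 0` for each of them since the
intensity of a simple Poisson process has no atoms of finite mass. [cite: Kingman1993, §2.2 Disjointness Lemma, p. 14, (2.15)] -/
theorem ae_count_union_eq_add [SigmaFinite ν₂] (h₁ : IsPoissonPointProcess ν₁ P₁)
    (h₂ : IsPoissonPointProcess ν₂ P₂) {s : Set E} (hs : MeasurableSet s) (hfin : ν₁ s ≠ ∞) :
    ∀ᵐ p ∂(P₁.prod P₂), (p.1 ∪ p.2).count s = p.1.count s + p.2.count s := by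
  haveI := h₁.isProbabilityMeasure
  haveI := h₂.isProbabilityMeasure
  have hmeas : MeasurableSet {p : PointConfig E × PointConfig E |
      (p.1 ∪ p.2).count s = p.1.count s + p.2.count s} :=
    measurableSet_eq_fun ((PointConfig.measurable_count hs).comp PointConfig.measurable_union')
      (((PointConfig.measurable_count hs).comp measurable_fst).add
        ((PointConfig.measurable_count hs).comp measurable_snd))
  rw [Measure.ae_prod_iff_ae_ae hmeas]
  filter_upwards [h₁.count_ae_lt_top hs hfin] with c hc
  have hcfin : (c.carrier ∩ s).Finite := Set.encard_lt_top_iff.1 hc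
  -- a.s. the second configuration contains none of the finitely many points of `c` in `s`
  have hnull : ∀ᵐ d ∂P₂, ∀ x ∈ c.carrier ∩ s, x ∉ d := by
    rw [ae_ball_iff hcfin.countable]
    intro x _
    rw [ae_iff]
    simpa only [not_not] using h₂.measure_setOf_mem_eq_zero (measurableSet_singleton x)
  filter_upwards [hnull] with d hd
  rw [PointConfig.count, PointConfig.count, PointConfig.count, PointConfig.carrier_union,
    union_inter_distrib_right]
  exact Set.encard_union_eq (Set.disjoint_left.2 fun x hx hx' => hd x hx hx'.1)

/-- **Disjointness Lemma, global form** (Kingman 1993, §2.2, p. 15: "true with `A = S` if `μ₁` and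
`μ₂` are σ-finite"): two independent Poisson processes with σ-finite intensities almost surely
have no point in common. (On each set of a countable cover by sets of finite intensity both counts
are a.s. finite and a.s. add up, `ae_count_union_eq_add`, which for finite sets forces
disjointness.) [cite: Kingman1993, §2.2 Disjointness Lemma, p. 15] -/
theorem ae_disjoint_carrier [SigmaFinite ν₁] [SigmaFinite ν₂] (h₁ : IsPoissonPointProcess ν₁ P₁)
    (h₂ : IsPoissonPointProcess ν₂ P₂) :
    ∀ᵐ p ∂(P₁.prod P₂), Disjoint p.1.carrier p.2.carrier := by
  haveI := h₁.isProbabilityMeasure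
  haveI := h₂.isProbabilityMeasure
  -- a countable cover of `E` by sets of finite intensity for both processes
  set T : ℕ × ℕ → Set E := fun mn => spanningSets ν₁ mn.1 ∩ spanningSets ν₂ mn.2 with hT
  have hTm : ∀ mn, MeasurableSet (T mn) := fun mn =>
    (measurableSet_spanningSets ν₁ mn.1).inter (measurableSet_spanningSets ν₂ mn.2)
  have hT1 : ∀ mn, ν₁ (T mn) ≠ ∞ := fun mn =>
    ne_top_of_le_ne_top (measure_spanningSets_lt_top ν₁ mn.1).ne (measure_mono inter_subset_left)
  have hT2 : ∀ mn, ν₂ (T mn) ≠ ∞ := fun mn =>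
    ne_top_of_le_ne_top (measure_spanningSets_lt_top ν₂ mn.2).ne (measure_mono inter_subset_right)
  have hcover : ∀ x : E, ∃ mn, x ∈ T mn := fun x =>
    ⟨(spanningSetsIndex ν₁ x, spanningSetsIndex ν₂ x), mem_spanningSetsIndex ν₁ x,
      mem_spanningSetsIndex ν₂ x⟩
  -- on each set of the cover the two configurations are a.s. disjoint
  have hloc : ∀ mn, ∀ᵐ p ∂(P₁.prod P₂), Disjoint (p.1.carrier ∩ T mn) (p.2.carrier ∩ T mn) := by
    intro mn
    have ha := ae_count_union_eq_add h₁ h₂ (hTm mn) (hT1 mn)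
    have hb : ∀ᵐ p ∂(P₁.prod P₂), p.1.count (T mn) < ⊤ :=
      (Measure.quasiMeasurePreserving_fst (μ := P₁) (ν := P₂)).ae
        (h₁.count_ae_lt_top (hTm mn) (hT1 mn))
    have hc : ∀ᵐ p ∂(P₁.prod P₂), p.2.count (T mn) < ⊤ :=
      (Measure.quasiMeasurePreserving_snd (μ := P₁) (ν := P₂)).ae
        (h₂.count_ae_lt_top (hTm mn) (hT2 mn))
    filter_upwards [ha, hb, hc] with p hpa hpb hpc
    simp only [PointConfig.count, PointConfig.carrier_union, union_inter_distrib_right] at hpa hpb hpc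
    exact disjoint_of_encard_union_eq_add (Set.encard_lt_top_iff.1 hpb)
      (Set.encard_lt_top_iff.1 hpc) hpa
  rw [← ae_all_iff] at hloc
  filter_upwards [hloc] with p hp
  rw [Set.disjoint_left]
  intro x hx1 hx2
  obtain ⟨mn, hmn⟩ := hcover x
  exact Set.disjoint_left.1 (hp mn) ⟨hx1, hmn⟩ ⟨hx2, hmn⟩

end Disjointness

/-- **Superposition Theorem** (Kingman, *Poisson Processes* (1993), §2.2, p. 16, (2.19)–(2.21);
discharge of the named fact `IsPoissonPointProcess.superposition`). On a second countable Hausdorff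
Borel space, the union of two independent Poisson point processes with σ-finite intensities
`ν₁, ν₂` — the image of `P₁ ⊗ P₂` under `(c, d) ↦ c ∪ d` — is a Poisson point process with
intensity `ν₁ + ν₂`. Proof as printed: by the Disjointness Lemma `N(A) = N₁(A) + N₂(A)` almost
surely (`ae_disjoint_carrier`); for `(ν₁ + ν₂)(A) < ∞` this is a sum of independent Poisson
variables, hence Poisson with mean `ν₁(A) + ν₂(A)` (Countable Additivity Theorem, §1.2; Mathlib's
`IndepFun.hasLaw_add_map_cast_poissonMeasure`); for disjoint `A₁, …, Aₙ` the array
`(N₁(Aⱼ), N₂(Aⱼ))ⱼ` is independent under the product law (`iIndepFun_prodMk_prod`), hence so are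
the sums `N(Aⱼ)`. [cite: Kingman1993, §2.2 Superposition Theorem, p. 16, (2.19)–(2.21)] -/
theorem superposition_holds : superposition (E := E) := by
  intro _ _ _ ν₁ ν₂ _ _ P₁ P₂ h₁ h₂
  haveI := h₁.isProbabilityMeasure
  haveI := h₂.isProbabilityMeasure
  have hU : Measurable fun p : PointConfig E × PointConfig E => p.1 ∪ p.2 :=
    PointConfig.measurable_union'
  have hcount : ∀ {s : Set E}, MeasurableSet s →
      Measurable fun c : PointConfig E => c.count s := fun hs => PointConfig.measurable_count hs
  -- Disjointness Lemma: a.s. the counts of the union are the sums of the counts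
  have hadd : ∀ s : Set E, (fun p : PointConfig E × PointConfig E => (p.1 ∪ p.2).count s)
      =ᵐ[P₁.prod P₂] fun p => p.1.count s + p.2.count s := fun s =>
    (ae_disjoint_carrier h₁ h₂).mono fun p hp => PointConfig.count_union_eq_add_of_disjoint hp s
  refine ⟨Measure.isProbabilityMeasure_map hU.aemeasurable, fun s hs hfin => ?_,
    fun n s hs hd => ?_⟩
  · -- one-dimensional marginals: a sum of two independent Poisson counts
    rw [Measure.add_apply] at hfin ⊢
    have h1fin : ν₁ s ≠ ∞ := ne_top_of_le_ne_top hfin le_self_add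
    have h2fin : ν₂ s ≠ ∞ := ne_top_of_le_ne_top hfin le_add_self
    rw [Measure.map_map (hcount hs) hU,
      show ((fun c : PointConfig E => c.count s) ∘ fun p : PointConfig E × PointConfig E =>
        p.1 ∪ p.2) = fun p => (p.1 ∪ p.2).count s from rfl,
      Measure.map_congr (hadd s), ENNReal.toNNReal_add h1fin h2fin]
    have hX : HasLaw (fun p : PointConfig E × PointConfig E => p.1.count s)
        ((poissonMeasure (ν₁ s).toNNReal).map (Nat.cast : ℕ → ℕ∞)) (P₁.prod P₂) := by
      refine ⟨((hcount hs).comp measurable_fst).aemeasurable, ?_⟩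
      rw [show (fun p : PointConfig E × PointConfig E => p.1.count s) =
          (fun c : PointConfig E => c.count s) ∘ Prod.fst from rfl,
        ← Measure.map_map (hcount hs) measurable_fst, Measure.map_fst_prod, measure_univ,
        one_smul]
      exact h₁.map_count hs h1fin
    have hY : HasLaw (fun p : PointConfig E × PointConfig E => p.2.count s)
        ((poissonMeasure (ν₂ s).toNNReal).map (Nat.cast : ℕ → ℕ∞)) (P₁.prod P₂) := by
      refine ⟨((hcount hs).comp measurable_snd).aemeasurable, ?_⟩
      rw [show (fun p : PointConfig E × PointConfig E => p.2.count s) =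
          (fun c : PointConfig E => c.count s) ∘ Prod.snd from rfl,
        ← Measure.map_map (hcount hs) measurable_snd, Measure.map_snd_prod, measure_univ,
        one_smul]
      exact h₂.map_count hs h2fin
    have hXY : IndepFun (fun p : PointConfig E × PointConfig E => p.1.count s)
        (fun p : PointConfig E × PointConfig E => p.2.count s) (P₁.prod P₂) :=
      indepFun_prod (hcount hs) (hcount hs)
    exact (hXY.hasLaw_add_map_cast_poissonMeasure hX hY).map_eq
  · -- independence over pairwise disjoint sets
    refine iIndepFun_map_of_comp_measurable hU (fun i => hcount (hs i)) ?_
    have hae : ∀ i, ((fun c : PointConfig E => c.count (s i)) ∘ fun p : PointConfig E ×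
        PointConfig E => p.1 ∪ p.2) =ᵐ[P₁.prod P₂] fun p => p.1.count (s i) + p.2.count (s i) :=
      fun i => hadd (s i)
    rw [iIndepFun_congr hae]
    have hpair : iIndepFun (fun i (p : PointConfig E × PointConfig E) =>
        (p.1.count (s i), p.2.count (s i))) (P₁.prod P₂) :=
      iIndepFun_prodMk_prod (fun i => hcount (hs i)) (fun i => hcount (hs i))
        (h₁.iIndepFun_count hs hd) (h₂.iIndepFun_count hs hd)
    exact hpair.comp (fun _ (q : ℕ∞ × ℕ∞) => q.1 + q.2) fun _ => measurable_of_countable _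

end IsPoissonPointProcess

end Literature.Analysis.FunctionSpaces
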